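import Literature.Analysis.FluidPDE.DissipationAnomalyProofs
import Literature.Analysis.FluidPDE.PassiveScalarForcedRenormalized
import Literature.Analysis.FluidPDE.PassiveScalarUniquenessL1Sobolev
import Summits.AnomalousDissipation.AnomalousDissipation.Theses.TwoAndHalfD
import Summits.AnomalousDissipation.AnomalousDissipation.Theorems.TwoAndHalfDSourcedScalarUnique2DDifference

/-!
# Route TwoAndHalfD (AnomalousDissipation) — support item `SourcedScalarUnique2D`

Settles stmt-AnomalousDissipation-14323 (`SourcedScalarUnique2D`): for `ν > 0`, every `T`, every
2-D global Leray–Hopf velocity `v` (`Torus.IsGlobalLerayHopf ν (fun _ => g) v₀ v`) and two weak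
solutions `θ₁, θ₂ ∈ L^∞_t L²_x` of the sourced advection–diffusion equation
`∂ₜθ + v·∇θ = νΔθ + h` on `[0,T)` with the same datum and source
(`Torus.IsWeakScalarTransportForcedOn T ν v (fun _ => h) θ₀ θᵢ`), `θ₁ t = θ₂ t` a.e. in `x` for
a.e. `t ∈ (0,T)`.

## Proof

Not the duality route suggested in the item's docstring, but DiPerna–Lions renormalisation
(DiPerna–Lions 1989, Thm. II.2–II.3 / Cor. II.1 with the integrability pairing `p = q = 2`:
drifts in `L¹(0,T; W^{1,2})`, solutions in `L^∞(0,T; L²)`; the viscous term only helps), all of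
whose analysis is in `Literature/Analysis/FluidPDE`:

1. `w = θ₁ - θ₂` is a weak solution of the HOMOGENEOUS equation with datum `0`
   (`isWeakScalarTransportOn_sub`, file `TwoAndHalfDSourcedScalarUnique2DDifference`: the source
   and datum terms of the two sourced weak identities cancel), and so is the zero scalar
   (`IsWeakScalarTransportForcedOn.isWeakScalarTransportOn_zero`).
2. A Leray–Hopf field has `∫₀ᵀ ‖∇v‖²_{L²} < ∞` (`IsLerayHopfOn.lintegral_eGradNormSq_lt_top`),
   hence `∫₀ᵀ ‖∇v‖_{L²} < ∞` (`x^{1/2} ≤ 1 + x` on the finite interval).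
3. DiPerna–Lions uniqueness for `L¹ₜ Ḣ¹ₓ` drifts with viscosity
   (`IsWeakScalarTransportOn.unique_of_lintegral_eGradNormSq_rpow_lt_top`, proved in the tree by
   the renormalised energy inequality and Fourier uniqueness of the slices) applied to the pair
   `(w, 0)` gives `w(t) = 0` a.e. in `x` for a.e. `t`.

No hypothesis on `g`, `h`, `θ₀` and no use of the dimension is needed; `T ≤ 0` is vacuous. The
result is unconditional.

## References

* R. J. DiPerna, P.-L. Lions, *Ordinary differential equations, transport theory and Sobolev
  spaces*, Invent. Math. 98 (1989), 511–547, §II.1, Thm. II.2, Cor. II.1, §II.3 Thm. II.3.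
  [`DiPernaLions1989`]
-/

noncomputable section

open MeasureTheory Set Filter Function TopologicalSpace
open scoped ENNReal NNReal InnerProductSpace

namespace Summit.AnomalousDissipation.AnomalousDissipation.Theorems

-- D-0017: single-problem summit ⇒ `Summit.AnomalousDissipation.AnomalousDissipation.…` by design.
set_option linter.dupNamespace false

open Literature.Analysis Literature.Analysis.FluidPDE Literature.Analysis.FluidPDE.Torus

/-- Settles stmt-AnomalousDissipation-14323 (route `TwoAndHalfD`, support): UNIQUENESS OF WEAK
SOURCED SCALARS OVER A 2-D LERAY–HOPF DRIFT. For `ν > 0`, any `T`, any global Leray–Hopf velocity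
`v` on `𝕋²` and two weak solutions `θ₁, θ₂ ∈ L^∞_t L²_x` of `∂ₜθ + v·∇θ = νΔθ + h` on `[0,T)`
with the same datum and source, `θ₁(t) = θ₂(t)` a.e. in `x` for a.e. `t ∈ (0,T)`.
Proof: `θ₁ - θ₂` and `0` are weak solutions of the homogeneous equation with datum `0`
(`isWeakScalarTransportOn_sub`, `isWeakScalarTransportOn_zero`); a Leray–Hopf field has
`∫₀ᵀ ‖∇v‖_{L²} ≤ T + ∫₀ᵀ ‖∇v‖²_{L²} < ∞` (`IsLerayHopfOn.lintegral_eGradNormSq_lt_top`); the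
tree's DiPerna–Lions uniqueness theorem for `L¹ₜ Ḣ¹ₓ` drifts with viscosity
(`IsWeakScalarTransportOn.unique_of_lintegral_eGradNormSq_rpow_lt_top`; DiPerna–Lions 1989,
Thm. II.2–II.3, Cor. II.1 with `p = q = 2`) identifies them. [cite: DiPernaLions1989, Cor. II.1] -/
theorem sourcedScalarUnique2D_proof :
    Summit.AnomalousDissipation.AnomalousDissipation.Theses.TwoAndHalfD.SourcedScalarUnique2D := by
  unfold Summit.AnomalousDissipation.AnomalousDissipation.Theses.TwoAndHalfD.SourcedScalarUnique2D
  intro T ν g h v₀ v θ₀ θ₁ θ₂ hν hLH h₁ h₂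
  rcases le_or_gt T 0 with hT | hT
  · rw [Set.Ioo_eq_empty_of_le hT, MeasureTheory.Measure.restrict_empty, MeasureTheory.ae_zero]
    exact Filter.eventually_bot
  have hLHT := hLH T hT
  -- the difference and the zero scalar solve the homogeneous equation with datum `0`
  have hw := isWeakScalarTransportOn_sub h₁ h₂
  have h0 := h₁.isWeakScalarTransportOn_zero
  -- `∫₀ᵀ ‖∇v‖_{L²} < ∞` from the Leray–Hopf bound `∫₀ᵀ ‖∇v‖²_{L²} < ∞`
  have hhalf : ∀ x : ℝ≥0∞, x ^ (1 / 2 : ℝ) ≤ 1 + x := fun x => by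
    rcases le_total x 1 with hx | hx
    · exact (ENNReal.rpow_le_one hx (by norm_num)).trans le_self_add
    · exact ((ENNReal.rpow_le_rpow_of_exponent_le hx (by norm_num : (1 / 2 : ℝ) ≤ 1)).trans_eq
        (ENNReal.rpow_one x)).trans le_add_self
  have hG : ∫⁻ t in Ioo 0 T, FunctionSpaces.Torus.eGradNormSq (v t) ^ (1 / 2 : ℝ) < ⊤ := by
    refine lt_of_le_of_lt (lintegral_mono fun t => hhalf _) ?_
    rw [lintegral_add_left measurable_const, setLIntegral_const]
    exact ENNReal.add_lt_top.2
      ⟨ENNReal.mul_lt_top ENNReal.one_lt_top measure_Ioo_lt_top, hLHT.lintegral_eGradNormSq_lt_top⟩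
  -- DiPerna–Lions uniqueness at Sobolev level identifies `θ₁ - θ₂` with `0`
  have hz := IsWeakScalarTransportOn.unique_of_lintegral_eGradNormSq_rpow_lt_top hν hw h0 hG
  filter_upwards [hz] with t ht
  filter_upwards [ht] with x hx
  exact sub_eq_zero.1 hx

end Summit.AnomalousDissipation.AnomalousDissipation.Theorems

end
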